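import Literature.AnabelianGeometry.SemiGraphs.FreeProPRankTwoGluing
import Literature.AnabelianGeometry.SemiGraphs.TwistUniformConvergence
import Literature.AnabelianGeometry.SemiGraphs.CharacteristicOpenCore
import Mathlib.Order.Filter.AtTopBot.Basic
import HarnessLib

/-!
# The Nielsen twists of `F̂₂⁽ᵖ⁾` converge to the identity modulo the characteristic open cores
# ([SemiAnbd] Thm 3.7 (iii) p. 40 — countermodel bookkeeping; Ribes–Zalesskii §2.1)

Mochizuki, *Semi-graphs of anabelioids*, Publ. RIMS **42** (2006), Thm. 3.7 (iii) p. 40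
[cite: MochizukiSemiAnbd2006, Thm 3.7(iii) p.40]; pro-`p` groups [cite: RibesZalesskii2010, §2.1].

PROOF-ONLY file (no definitions).  Context: FRONTIER programme SUBDAG-REFUTE-F1732 of cell abc-iut
(kernel refutation of the ∀-countable reading of [SemiAnbd] Thm. 3.7 (iii); print proves finite `𝔾`,
kernel `compactInVerticialAt_of_finiteGraph`).  This file is the GROUP side of the level-coincidence
binder `hz` / `hcoin` of the escape assembly (abc-iut-L3-d4 `ThetaRayEscape`, abc-iut-L3-t11
`TemperedPiRayLimitElement`) at brick R1's data (abc-iut-w6-d019, `FreeProPRankTwo*`): the free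
pro-`p` group `Grp p = F̂₂⁽ᵖ⁾` on `a, b`, its Nielsen twists `θ n` (`θ n a = a·b^{pⁿ}`, `θ n b = b`)
and the edge embedding `α : ℤ_p → Grp p`, `α 1 = a`.  By brick R1b (abc-iut-w5-d215,
`TwistUniformConvergence`: `θ_n → id` uniformly modulo every open normal subgroup of a pro-`p`
completion) and the openness / normality of the characteristic open cores of a topologically finitely
generated profinite group (`CharacteristicOpenCore`):

* `exists_forall_θ_mul_inv_mem` (+ three orientations): for every open normal `U ≤ Grp p` there is
  `n₀` with `θ n x · x⁻¹ ∈ U` for all `n ≥ n₀` and all `x`;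
* `exists_forall_θ_mul_inv_mem_charOpenCore` (+ orientations), `exists_forall_b_pow_mem_charOpenCore`:
  the same for `U := charOpenCore (Grp p) d`, and `b^{pⁿ} ∈ charOpenCore (Grp p) d` for `n ≫ 0`;
* `exists_forall_inv_θHom_α_mul_α_mem_charOpenCore`: for a schedule `n : ℕ → ℕ` tending to `∞`
  (e.g. strictly increasing) and every `e₀ : ℤ_p`, `d : ℕ`:
  `∃ N, ∀ k ≥ N, (θ_{n(k+1)} (α e₀))⁻¹ · α e₀ ∈ charOpenCore (Grp p) d` — VERBATIM the binder
  `hcoinG` of the generic level-data instantiation at `thetaRayOfTwists (Grp p) ℤ_p α (θHom p) n`;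
* `forall_exists_forall_inv_θα_mul_α_mem_charOpenCore`, `thetaRay_hcoin(_of_strictMono)`: the same in
  the `θα` spelling of `thetaRay (Grp p) ℤ_p (α p) (fun k => θα p (n k))` (= `thetaRayFreeProP p n`),
  i.e. VERBATIM the binder `hcoin` of `thetaRay_not_compactInVerticial_of_hcrit`
  (abc-iut-L3-t11, `ThetaRayEscapeLevelData`).

Nothing here is asserted about any semi-graph; nothing here bears on [IUTchIII] Cor. 3.12 (IUT uses
finite dual semi-graphs); typed ≠ proved for the programme as a whole.
-/

namespace Literature.AnabelianGeometry.SemiGraphs.FreeProPRankTwo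

open Filter Topology

variable (p : ℕ)

/-! ### `θ_n → id` modulo an arbitrary open normal subgroup (no primality needed) -/

/-- **`θ_n → id` uniformly modulo every open normal subgroup of `F̂₂⁽ᵖ⁾`**: for `U` open normal there
is `n₀` with `θ n x · x⁻¹ ∈ U` for all `n ≥ n₀`, `x ∈ Grp p` (brick R1b at R1's data).
[cite: MochizukiSemiAnbd2006, Thm 3.7(iii) p.40] -/
theorem exists_forall_θ_mul_inv_mem (U : Subgroup (Grp p)) [U.Normal] (hU : IsOpen (U : Set (Grp p))) :
    ∃ n₀ : ℕ, ∀ n, n₀ ≤ n → ∀ x : Grp p, θ p n x * x⁻¹ ∈ U :=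
  (isProSigmaCompletion_ι p).exists_forall_twist_mul_inv_mem_equiv (θ p) (fun n => θ_a p n)
    (fun n => θ_b p n) U hU

/-- Orientation `(θ n x)⁻¹ · x ∈ U`. [cite: MochizukiSemiAnbd2006, Thm 3.7(iii) p.40] -/
theorem exists_forall_inv_θ_mul_mem (U : Subgroup (Grp p)) [hN : U.Normal]
    (hU : IsOpen (U : Set (Grp p))) :
    ∃ n₀ : ℕ, ∀ n, n₀ ≤ n → ∀ x : Grp p, (θ p n x)⁻¹ * x ∈ U := by
  obtain ⟨n₀, h⟩ := exists_forall_θ_mul_inv_mem p U hU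
  refine ⟨n₀, fun n hn x => ?_⟩
  have h1 : x⁻¹ * (θ p n x * x⁻¹)⁻¹ * x⁻¹⁻¹ ∈ U := hN.conj_mem _ (inv_mem (h n hn x)) x⁻¹
  simpa only [mul_inv_rev, inv_inv, inv_mul_cancel_left] using h1

/-- Orientation `x⁻¹ · θ n x ∈ U`. [cite: MochizukiSemiAnbd2006, Thm 3.7(iii) p.40] -/
theorem exists_forall_inv_mul_θ_mem (U : Subgroup (Grp p)) [U.Normal] (hU : IsOpen (U : Set (Grp p))) :
    ∃ n₀ : ℕ, ∀ n, n₀ ≤ n → ∀ x : Grp p, x⁻¹ * θ p n x ∈ U := by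
  obtain ⟨n₀, h⟩ := exists_forall_inv_θ_mul_mem p U hU
  refine ⟨n₀, fun n hn x => ?_⟩
  simpa only [mul_inv_rev, inv_inv] using inv_mem (h n hn x)

/-- Orientation `x · (θ n x)⁻¹ ∈ U`. [cite: MochizukiSemiAnbd2006, Thm 3.7(iii) p.40] -/
theorem exists_forall_mul_inv_θ_mem (U : Subgroup (Grp p)) [U.Normal] (hU : IsOpen (U : Set (Grp p))) :
    ∃ n₀ : ℕ, ∀ n, n₀ ≤ n → ∀ x : Grp p, x * (θ p n x)⁻¹ ∈ U := by
  obtain ⟨n₀, h⟩ := exists_forall_θ_mul_inv_mem p U hU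
  refine ⟨n₀, fun n hn x => ?_⟩
  simpa only [mul_inv_rev, inv_inv] using inv_mem (h n hn x)

/-! ### Modulo the characteristic open cores -/

/-- The characteristic open core `charOpenCore (Grp p) d` is open (topological finite generation of
`F̂₂⁽ᵖ⁾`; private plumbing — brick R1 part 3 `FreeProPRankTwoLevels` carries the public statement
`isOpen_charOpenCore`). [folklore] -/
private theorem isOpen_charOpenCore' (d : ℕ) : IsOpen (charOpenCore (Grp p) d : Set (Grp p)) :=
  isOpen_charOpenCore_of_tfg (isTopologicallyFinitelyGenerated p) d

/-- **`θ_n → id` modulo `charOpenCore (Grp p) d`**: `θ n x · x⁻¹ ∈ charOpenCore (Grp p) d` for all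
`n ≥ n₀(d)` and all `x`. [cite: MochizukiSemiAnbd2006, Thm 3.7(iii) p.40] -/
theorem exists_forall_θ_mul_inv_mem_charOpenCore (d : ℕ) :
    ∃ n₀ : ℕ, ∀ n, n₀ ≤ n → ∀ x : Grp p, θ p n x * x⁻¹ ∈ charOpenCore (Grp p) d := by
  haveI : (charOpenCore (Grp p) d).Normal := charOpenCore_normal d
  exact exists_forall_θ_mul_inv_mem p _ (isOpen_charOpenCore' p d)

/-- `(θ n x)⁻¹ · x ∈ charOpenCore (Grp p) d` for `n ≥ n₀(d)`. [cite: MochizukiSemiAnbd2006, Thm 3.7(iii) p.40] -/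
theorem exists_forall_inv_θ_mul_mem_charOpenCore (d : ℕ) :
    ∃ n₀ : ℕ, ∀ n, n₀ ≤ n → ∀ x : Grp p, (θ p n x)⁻¹ * x ∈ charOpenCore (Grp p) d := by
  haveI : (charOpenCore (Grp p) d).Normal := charOpenCore_normal d
  exact exists_forall_inv_θ_mul_mem p _ (isOpen_charOpenCore' p d)

/-- `x⁻¹ · θ n x ∈ charOpenCore (Grp p) d` for `n ≥ n₀(d)`. [cite: MochizukiSemiAnbd2006, Thm 3.7(iii) p.40] -/
theorem exists_forall_inv_mul_θ_mem_charOpenCore (d : ℕ) :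
    ∃ n₀ : ℕ, ∀ n, n₀ ≤ n → ∀ x : Grp p, x⁻¹ * θ p n x ∈ charOpenCore (Grp p) d := by
  haveI : (charOpenCore (Grp p) d).Normal := charOpenCore_normal d
  exact exists_forall_inv_mul_θ_mem p _ (isOpen_charOpenCore' p d)

/-- `a⁻¹ · θ n a = b^{pⁿ}` — the element whose eventual membership in the cores IS the level
coincidence of consecutive edge generators of the countermodel. [cite: MochizukiSemiAnbd2006, Thm 3.7(iii) p.40] -/
theorem inv_a_mul_θ_a (n : ℕ) : (a p)⁻¹ * θ p n (a p) = b p ^ p ^ n := by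
  rw [θ_a, inv_mul_cancel_left]

/-- **`b^{pⁿ} ∈ charOpenCore (Grp p) d` for `n ≫ 0`** (pro-`p`: some `b^{p^e}` lies in the open core,
then all higher `p`-power powers do). [cite: RibesZalesskii2010, §2.1] -/
theorem exists_forall_b_pow_mem_charOpenCore (d : ℕ) :
    ∃ n₀ : ℕ, ∀ n, n₀ ≤ n → b p ^ p ^ n ∈ charOpenCore (Grp p) d := by
  obtain ⟨e, he⟩ := exists_pow_prime_pow_mem p (charOpenCore (Grp p) d) (isOpen_charOpenCore' p d) (b p)
  exact ⟨e, fun n hn => TwistConvergence.pow_prime_pow_mem_of_le _ he hn⟩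

/-! ### With `p` prime: the edge embedding `α` -/

variable [hp : Fact p.Prime]

/-! ### Along a schedule `n : ℕ → ℕ` tending to infinity: the binder `hcoinG` -/

/-- **The coincidence binder `hcoinG` at R1's data**, `θ` spelling: for a schedule `n → ∞`, every
`e₀ : ℤ_p` and every level bound `d`, `(θ_{n(k+1)} (α e₀))⁻¹ · α e₀ ∈ charOpenCore (Grp p) d` for
all `k ≥ N`. [cite: MochizukiSemiAnbd2006, Thm 3.7(iii) p.40] -/
theorem exists_forall_inv_θ_α_mul_α_mem_charOpenCore {n : ℕ → ℕ} (hn : Tendsto n atTop atTop)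
    (e₀ : Multiplicative ℤ_[p]) (d : ℕ) :
    ∃ N : ℕ, ∀ k, N ≤ k → (θ p (n (k + 1)) (α p e₀))⁻¹ * α p e₀ ∈ charOpenCore (Grp p) d := by
  obtain ⟨n₀, h⟩ := exists_forall_inv_θ_mul_mem_charOpenCore p d
  obtain ⟨N, hN⟩ := tendsto_atTop_atTop.1 hn n₀
  exact ⟨N, fun k hk => h _ (hN (k + 1) (le_trans hk (Nat.le_succ k))) _⟩

/-- **`hcoinG` VERBATIM** (`θHom` spelling, all `d` at once) at the datum
`thetaRayOfTwists (Grp p) (Multiplicative ℤ_[p]) (α p) (fun m => θHom p m) n` of the countermodel: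
`∀ d, ∃ N, ∀ k ≥ N, (θHom p (n (k+1)) (α p e₀))⁻¹ · α p e₀ ∈ charOpenCore (Grp p) d`.
[cite: MochizukiSemiAnbd2006, Thm 3.7(iii) p.40] -/
theorem forall_exists_forall_inv_θHom_α_mul_α_mem_charOpenCore {n : ℕ → ℕ}
    (hn : Tendsto n atTop atTop) (e₀ : Multiplicative ℤ_[p]) :
    ∀ d : ℕ, ∃ N : ℕ, ∀ k, N ≤ k →
      (θHom p (n (k + 1)) (α p e₀))⁻¹ * α p e₀ ∈ charOpenCore (Grp p) d :=
  fun d => exists_forall_inv_θ_α_mul_α_mem_charOpenCore p hn e₀ d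

/-- `hcoinG` for a strictly increasing schedule (memo §1: `n` strictly increasing).
[cite: MochizukiSemiAnbd2006, Thm 3.7(iii) p.40] -/
theorem forall_exists_forall_inv_θHom_α_mul_α_mem_charOpenCore_of_strictMono {n : ℕ → ℕ}
    (hn : StrictMono n) (e₀ : Multiplicative ℤ_[p]) :
    ∀ d : ℕ, ∃ N : ℕ, ∀ k, N ≤ k →
      (θHom p (n (k + 1)) (α p e₀))⁻¹ * α p e₀ ∈ charOpenCore (Grp p) d :=
  forall_exists_forall_inv_θHom_α_mul_α_mem_charOpenCore p hn.tendsto_atTop e₀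

/-- The opposite orientation `(α e₀)⁻¹ · θHom_{n(k+1)} (α e₀)` (in case the gluing convention of the
consumer puts the twisted branch second). [cite: MochizukiSemiAnbd2006, Thm 3.7(iii) p.40] -/
theorem forall_exists_forall_inv_α_mul_θHom_α_mem_charOpenCore {n : ℕ → ℕ}
    (hn : Tendsto n atTop atTop) (e₀ : Multiplicative ℤ_[p]) :
    ∀ d : ℕ, ∃ N : ℕ, ∀ k, N ≤ k →
      (α p e₀)⁻¹ * θHom p (n (k + 1)) (α p e₀) ∈ charOpenCore (Grp p) d := by
  intro d
  obtain ⟨n₀, h⟩ := exists_forall_inv_mul_θ_mem_charOpenCore p d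
  obtain ⟨N, hN⟩ := tendsto_atTop_atTop.1 hn n₀
  exact ⟨N, fun k hk => h _ (hN (k + 1) (le_trans hk (Nat.le_succ k))) _⟩

/-! ### `θα` spelling: the binder `hcoin` of `thetaRay_not_compactInVerticial_of_hcrit` at `𝒢_θ` -/

/-- **(hcoin) at the countermodel datum**, `θα` spelling: at
`𝒢_θ = thetaRay (Grp p) (Multiplicative ℤ_[p]) (α p) (fun k => θα p (n k))` (`thetaRayFreeProP p n`,
abc-iut-w6-d070) the binder `hcoin : ∀ d, ∃ N, ∀ k ≥ N, (low (k+1) e₀)⁻¹ · up e₀ ∈ charOpenCore G d` of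
abc-iut-L3-t11's `thetaRay_not_compactInVerticial_of_hcrit` reads, after `β`-reduction, exactly
`∀ d, ∃ N, ∀ k ≥ N, (θα p (n (k+1)) e₀)⁻¹ · α p e₀ ∈ charOpenCore (Grp p) d`; it holds for every schedule
`n → ∞`. [cite: MochizukiSemiAnbd2006, Thm 3.7(iii) p.40] -/
theorem forall_exists_forall_inv_θα_mul_α_mem_charOpenCore {n : ℕ → ℕ}
    (hn : Tendsto n atTop atTop) (e₀ : Multiplicative ℤ_[p]) :
    ∀ d : ℕ, ∃ N : ℕ, ∀ k, N ≤ k →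
      (θα p (n (k + 1)) e₀)⁻¹ * α p e₀ ∈ charOpenCore (Grp p) d :=
  forall_exists_forall_inv_θHom_α_mul_α_mem_charOpenCore p hn e₀

/-- (hcoin) at the countermodel datum for a strictly increasing schedule (memo §1), in the UN-reduced
binder shape `((fun k => θα p (n k)) (k+1) e₀)⁻¹ * (α p) e₀`. [cite: MochizukiSemiAnbd2006, Thm 3.7(iii) p.40] -/
theorem thetaRay_hcoin_of_strictMono {n : ℕ → ℕ} (hn : StrictMono n) (e₀ : Multiplicative ℤ_[p]) :
    ∀ d : ℕ, ∃ N : ℕ, ∀ k, N ≤ k →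
      ((fun k => θα p (n k)) (k + 1) e₀)⁻¹ * (α p) e₀ ∈ charOpenCore (Grp p) d :=
  forall_exists_forall_inv_θα_mul_α_mem_charOpenCore p hn.tendsto_atTop e₀

/-- (hcoin) at the countermodel datum for ANY schedule tending to infinity, un-reduced binder shape.
[cite: MochizukiSemiAnbd2006, Thm 3.7(iii) p.40] -/
theorem thetaRay_hcoin {n : ℕ → ℕ} (hn : Tendsto n atTop atTop) (e₀ : Multiplicative ℤ_[p]) :
    ∀ d : ℕ, ∃ N : ℕ, ∀ k, N ≤ k →
      ((fun k => θα p (n k)) (k + 1) e₀)⁻¹ * (α p) e₀ ∈ charOpenCore (Grp p) d :=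
  forall_exists_forall_inv_θα_mul_α_mem_charOpenCore p hn e₀

end Literature.AnabelianGeometry.SemiGraphs.FreeProPRankTwo
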